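import Summits.HodgeConjecture.HodgeConjecture.Theorems.GenericDivisibilityHodgeClassesGenericallyDivisibleSmallChow
import Literature.AlgebraicGeometry.HodgeTheory.ZariskiOpenBettiFinitenessProofs
import HarnessLib

/-!
# Route `GenericDivisibility`, crux C1 `HodgeClassesGenericallyDivisible`: the finiteness hypothesis discharged

Sub-problem `HodgeConjecture` of the summit `HodgeConjecture`, route `GenericDivisibility`
(`Summits/HodgeConjecture/HodgeConjecture/Theses/GenericDivisibility.lean`), crux C1
`HodgeClassesGenericallyDivisible` (item `stmt-HodgeConjecture-18466`).

The reductions of `GenericDivisibilityHodgeClassesGenericallyDivisibleFinite` ("HC ⟹ C1", the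
pointwise form, the `p = 1` instance) and of `…SmallChow` (the small-Chow-group sector) all carried
the hypothesis `hfin` — finite generation of the integral homology of the complex points of the
non-empty Zariski opens of smooth projective complex varieties (Dimca 1992, Ch. 1 Cor. (6.10)),
vendored as the named fact `Dimca1992_finite_singularHomology_complexPointsCompl`. That fact is now a
THEOREM of the tree (`Dimca1992_finite_singularHomology_complexPointsCompl_holds`,
`Literature/AlgebraicGeometry/HodgeTheory/ZariskiOpenBettiFinitenessProofs`: semialgebraic model and
triangulation of the pair `(X(ℂ), Z(ℂ))`, complement of a subcomplex = finite union of open stars,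
Mayer–Vietoris; degree one independently in `ZariskiOpenHOneFiniteness`, whence the `p = 1` instance
granted only `TorsionDiesGenerically` in `…Surface`). This file records the remaining reductions with
`hfin` removed:

* `hodgeClassesGenericallyDivisible_of_torsionDiesGenerically_of_hodgeConjecture` — **C1 follows from
  the Hodge conjecture granted only the route's own support item `TorsionDiesGenerically`** (the
  registered sub-goal of the crux item; no printed theorem is assumed any more besides what
  `TorsionDiesGenerically` encapsulates);
* `hodgeClassesGenericallyDivisible_of_hodgeConjecture_of_colliotTheleneVoisin` — the same with
  `TorsionDiesGenerically` supplied by the one named fact `ColliotTheleneVoisin2012_torsionDiesGenerically`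
  (CT–Voisin 2012 Thm. 3.1, Bloch–Kato): **trust base of "C1 is HC-implied" = one printed theorem**;
* `genericDivisibility_exists_restrict_eq_zero_of_hodgeConjectureFor'` — pointwise: HC for the one
  `2p`-fold `X` and `TorsionDiesGenerically` give C1 for `X` (with `y = 0`);
* `hodgeClassesGenericallyDivisible_of_chowGroups_rank_le_one_of_colliotTheleneVoisin` — the
  small-Chow-group sector (Vial 2013, PROVED in the tree) granted only CT–Voisin Thm. 3.1.

## References

* [Dimca1992] A. Dimca, Singularities and Topology of Hypersurfaces, Springer 1992, Ch. 1 Cor. (6.10).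
* [ColliotTheleneVoisin2012] J.-L. Colliot-Thélène, C. Voisin, Cohomologie non ramifiée et
  conjecture de Hodge entière, Duke Math. J. 161 (2012), Thm. 3.1, Prop. 3.3, §4.1.
* [Vial2013] Ch. Vial, Algebraic cycles and fibrations, Doc. Math. 18 (2013), Thm. 4.
* [VoisinHodgeI2002] C. Voisin, Hodge Theory and Complex Algebraic Geometry I, CUP 2002, Thm. 11.30.
* [Deligne2000] P. Deligne, The Hodge conjecture, Clay Mathematics Institute (2000), §1.
-/

-- `Summit.HodgeConjecture.HodgeConjecture.Theorems` is the mandated namespace (single-problem summit: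
-- Problem = Summit), which `linter.dupNamespace` flags on every declaration; the lakefile turns the
-- linter off tree-wide (weak option), restated here so stand-alone elaboration is warning-free too.
set_option linter.dupNamespace false

noncomputable section

namespace Summit.HodgeConjecture.HodgeConjecture.Theorems

open CategoryTheory AlgebraicGeometry
open Literature.AlgebraicGeometry.Motives Literature.AlgebraicGeometry.HodgeTheory
open Literature.AlgebraicTopology.SingularHomology
open Summit.HodgeConjecture.HodgeConjecture.Theses.GenericDivisibility

/-! ### C1 from HC, granted only `TorsionDiesGenerically` -/

/-- **HC ∧ `TorsionDiesGenerically` ⟹ C1.** The crux `HodgeClassesGenericallyDivisible` follows from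
the Hodge conjecture (summit statement) granted only the route's support item
`TorsionDiesGenerically`: the finiteness hypothesis of
`hodgeClassesGenericallyDivisible_of_hodgeConjecture_of_finite` is the tree's theorem
`Dimca1992_finite_singularHomology_complexPointsCompl_holds`. Registered sub-goal of the crux item
(the formal content of "C1 is HC-implied"). [cite: ColliotTheleneVoisin2012, Thm 3.1]
[cite: Dimca1992, Ch. 1 Cor. (6.10)] [cite: Deligne2000, §1] -/
theorem hodgeClassesGenericallyDivisible_of_torsionDiesGenerically_of_hodgeConjecture :
    TorsionDiesGenerically → _root_.HodgeConjecture → HodgeClassesGenericallyDivisible :=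
  fun hT hHC ↦ hodgeClassesGenericallyDivisible_of_hodgeConjecture_of_finite
    (fun _n _X hX Z hZ _ k ↦ Dimca1992_finite_singularHomology_complexPointsCompl_holds hX Z hZ k)
    hT hHC

/-- **Colliot-Thélène–Voisin 2012 Thm. 3.1 ∧ HC ⟹ C1**: trust base of "C1 is HC-implied" reduced to
the one printed theorem `ColliotTheleneVoisin2012_torsionDiesGenerically` (torsion-freeness of the
Zariski sheaf `𝓗²ᵖ(ℤ)`, from the Rost–Voevodsky norm-residue theorem).
[cite: ColliotTheleneVoisin2012, Thm 3.1] [cite: Deligne2000, §1] -/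
theorem hodgeClassesGenericallyDivisible_of_hodgeConjecture_of_colliotTheleneVoisin
    (hT : ColliotTheleneVoisin2012_torsionDiesGenerically) (hHC : _root_.HodgeConjecture) :
    HodgeClassesGenericallyDivisible :=
  hodgeClassesGenericallyDivisible_of_torsionDiesGenerically_of_hodgeConjecture
    (genericDivisibility_torsionDiesGenerically_of_colliotTheleneVoisin hT) hHC

/-! ### Pointwise form and sectors, without the finiteness hypothesis -/

/-- **Pointwise form without the finiteness hypothesis**: for `p ≥ 1`, `X` smooth projective of
dimension `2p` with `HodgeConjectureFor (2p) X`, granted `TorsionDiesGenerically`, every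
`z ∈ H²ᵖ(X(ℂ); ℤ)` with `(p,p)` complexification restricts to `0` on the complex points of some
non-empty Zariski open (`genericDivisibility_exists_restrict_eq_zero_of_hodgeConjectureFor` with
`hfin` from `Dimca1992_finite_singularHomology_complexPointsCompl_holds`).
[cite: ColliotTheleneVoisin2012, Thm 3.1] [cite: Deligne2000, §1] -/
theorem genericDivisibility_exists_restrict_eq_zero_of_hodgeConjectureFor'
    {p : ℕ} {X : SchemeOver ℂ} (hp : 1 ≤ p) (hX : IsSmoothProjective (2 * p) X)
    (hHC : HodgeConjectureFor (2 * p) X) (hT : TorsionDiesGenerically)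
    (z : singularCohomology ℤ ℤ (ComplexPoints X) (2 * p))
    (hz : IsOfHodgeType (2 * p) X (2 * p) p p
      (singularCohomology.ringChange (Int.castRingHom ℂ) (ComplexPoints X) (2 * p) z)) :
    ∃ Z : Set X.left, IsClosed Z ∧ Z ≠ Set.univ ∧
      singularCohomology.map ℤ ℤ
        (⟨Subtype.val, continuous_subtype_val⟩ : C(complexPointsCompl X Z, ComplexPoints X))
        (2 * p) z = 0 :=
  genericDivisibility_exists_restrict_eq_zero_of_hodgeConjectureFor hp hX hHC hT
    (fun Z hZ _ ↦ Dimca1992_finite_singularHomology_complexPointsCompl_holds hX Z hZ (2 * p - 1)) z hz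

/-- **C1 on the small-Chow-group sector granted only Colliot-Thélène–Voisin 2012 Thm. 3.1.** For
`p ≥ 1` and `X` smooth projective of dimension `2p` over `ℂ` with `CH_i(X_L)` of rank `≤ 1` for all
`i ≤ p - 2` and every algebraically closed `L ⊇ ℂ` (for `p = 2`: `CH₀`-trivial fourfolds), HC for
`X` is the tree's theorem (Vial 2013), so every integral `(p,p)` class is divisible by every `m ≥ 1`
(indeed zero) on the complex points of a non-empty Zariski open — the known sector of the crux's first
open case, now modulo one printed theorem. [cite: Vial2013, Thm. 4]
[cite: ColliotTheleneVoisin2012, Thm 3.1 and Prop. 3.3] -/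
theorem hodgeClassesGenericallyDivisible_of_chowGroups_rank_le_one_of_colliotTheleneVoisin
    (hT : ColliotTheleneVoisin2012_torsionDiesGenerically)
    ⦃p : ℕ⦄ ⦃X : SchemeOver ℂ⦄ (hp : 1 ≤ p) (hX : IsSmoothProjective (2 * p) X)
    (hCH : ∀ (L : Type) [Field L] [IsAlgClosed L] [Algebra ℂ L] (i : ℕ), i ≤ (2 * p - 4) / 2 →
      ∀ a b : ChowGroup ((baseChange ℂ L).obj X).left i, ∃ m n : ℤ, (m ≠ 0 ∨ n ≠ 0) ∧ m • a = n • b)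
    (z : singularCohomology ℤ ℤ (ComplexPoints X) (2 * p))
    (hz : IsOfHodgeType (2 * p) X (2 * p) p p
      (singularCohomology.ringChange (Int.castRingHom ℂ) (ComplexPoints X) (2 * p) z))
    (m : ℕ) (hm : 1 ≤ m) :
    ∃ Z : Set X.left, IsClosed Z ∧ Z ≠ Set.univ ∧
      ∃ y : singularCohomology ℤ ℤ (complexPointsCompl X Z) (2 * p),
        m • y = singularCohomology.map ℤ ℤ
          (⟨Subtype.val, continuous_subtype_val⟩ : C(complexPointsCompl X Z, ComplexPoints X))
          (2 * p) z :=
  hodgeClassesGenericallyDivisible_of_chowGroups_rank_le_one_of_facts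
    Dimca1992_finite_singularHomology_complexPointsCompl_holds hT hp hX hCH z hz m hm

end Summit.HodgeConjecture.HodgeConjecture.Theorems

end
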